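import Literature.NumberTheory.GaloisCohomology.LocalPairingSubgroup
import Literature.NumberTheory.ComplexMultiplication.EllipticUnits.ImaginaryQuadraticMainConjectureCarriersO
import Literature.NumberTheory.EllipticCurves.GreenbergSelmerCofreeReductionPk
import Literature.NumberTheory.EllipticCurves.Kato2004.EllipticZetaReciprocity
import Literature.NumberTheory.GaloisRepresentations.LocalKummerTorsion
import Mathlib.NumberTheory.Padics.RingHoms
import HarnessLib

/-!
# Kato 2004 (Astérisque 295) §15 / §17.13 read at ONE place `v` of `K` with `𝒪`-coefficients: the CARRIERS of the
# finite-level local Tate pairings `H¹(K_{n,v}, 𝒪 ⊗ μ_{p^k} ⊗ θ′) × H¹(K_{n,v}, M[p^k]) → ℤ/p^k` in which the explicit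
# reciprocity law for the twisted elliptic-unit classes (Prop. 15.9, file `Kato2004/EllipticUnitTatePairingValuesK.lean`) is stated

Topic `NumberTheory/EllipticCurves`, sub-directory `Kato2004` (namespace = path, sub-namespace `LocalTate`). DEFINITIONS WITH
BODIES and their unfolding lemmas; no named fact, no instance, no notation, no `sorry`. Cell `pub/bsd-wall` / `bsd-inputs`
(D-0154 (2) INPUTS), seat `bsd-inputs-honda-p1` g31, for crux L `SmallImageLowerHalfBothSigns` (stmt-BirchSwinnertonDyer-23599) of
the BSD route `SignedLowerHalves`, line `rtt_w3` v40, row S4‴ (LEAD ruling «R-F1», 2026-08-31): the consumer there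
(`SmallImageRttReciprocity.exists_toDual_spec_zetaSp_eq_pairLoc_cofree_all`, `…exists_torsion_cocycle_reads_smul_conj`,
`…sum_ev_mul_pow_sub_eq_of_pairingLaw`) speaks exactly these carriers, there written in the Summits namespace
`SmallImageRttD2Seq` (width seat `bsd-line-slh-p3-w3` g21–g29); every definition below is a VERBATIM copy of the corresponding
Summits definition (same body), so that the two agree DEFINITIONALLY (`rfl`) and the Literature fact can be consumed without
transport. HONEST FRAMING: generic plumbing (discrete modules, torsion levels, restriction along `Γ_{K_v} → Γ_K → G_P`, the
trace-type coefficient pairing data `t ↦ t/p^k`, `ζ ↦ z·ζ`, `λ mod p^k`, and the `p𝔣`-depleted Hecke `L`-series); nothing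
arithmetic is proved here; BSD / crux L are not advanced by this file.

* §1 `localAction ι M` — `M|_{Γ_E}` along `res_ι : Γ_E → Γ_K` (a `def`, activated by `letI`; pin `localAction_smul`).
* §2 `torsionPow M p k = M[p^k]`, `repOfAction`, `torsRep M hstab p k : ContinuousRep G ℤ M[p^k]` (its restriction to a subgroup
  `S` IS `discreteTopRep S M[p^k]`, `rfl`).
* §3 `locGS`, `locCoeffRep S θ′ P v k` (the `G_P`-module `X_k = (𝒪 ⊗ μ_{p^k} ⊗ θ′)^{N_P}` of `levelCohO` restricted to `Γ_{K_v}`),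
  `locLayerHom`, `locLayerMod`, `locNK` (the localisation `H¹(G_P(K_n), X_k) → H¹(U_{n,v}, X_k)`, `U_{n,v} = res_v⁻¹ Gal(K̄/K_n)`).
* §4 `zmodSMulMu`, `lamZMod`, `divPowTors` — the vocabulary of the coefficient pairing `⟪a ⊗ ζ, t/p^k⟫ = λ(a t)·ζ`
  (`X_k × M[p^k] → μ_{p^k}`, `M = (F/𝒪)(θ)` = `GreenbergSelmer.Cofree θ F`), by which the fact PINS the pairing it quantifies over.
* §5 `depletedHeckeLSeriesIdeal`, `IsDepletedHeckeLIdeal` — Kato's `L_{p𝔣}(ψ̄, χ, s)` depleted at an IDEAL (the sibling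
  `CM.depletedHeckeLSeries` depletes at `(m)`, `m ∈ ℕ`), readings (R1)/(R2) of `EllipticZetaReciprocity.lean` kept.
References: [Kato2004Asterisque] §8.2 (p. 180), §15.7–15.9 (pp. 255–259), §17.13; [NeukirchSchmidtWingberg2008] I §5, (7.2.6);
[Rubin2000] §4.2, App. B.2; [SerreGaloisCohomology1997] I §2, II §1.1; [JohnsonLeungKings2011] Def. 4.2.
-/

set_option autoImplicit false
noncomputable section

open scoped Classical NumberField ComplexConjugate
open NumberField IsDedekindDomain Field CategoryTheory

namespace Literature.NumberTheory.EllipticCurves.Kato2004.LocalTate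

open Literature.NumberTheory.EllipticCurves Literature.NumberTheory.GaloisRepresentations
  Literature.NumberTheory.GaloisRepresentations.DiscreteGaloisModule
  Literature.NumberTheory.ComplexMultiplication.EllipticUnits.JohnsonLeungKings2011

/-! ## §1. The coefficient module at the place: `M` restricted along `res_ι : Γ_E → Γ_K` -/

section Coeff

variable {K : Type} [Field K] {E : Type} [Field E] [Algebra K E] (ι : AlgebraicClosure K →ₐ[K] AlgebraicClosure E)
  (M : Type) [AddCommGroup M] [DistribMulAction (absoluteGaloisGroup K) M]

/-- **`M|_{Γ_E}`**: the `Γ_E`-action on a `Γ_K`-module `M` obtained by restriction along `res_ι : Γ_E → Γ_K`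
(`DistribMulAction.compHom`). A `def` to be activated with `letI` (no instance); VERBATIM the Summits
`SmallImageRttD2Seq.localAction` (definitionally equal). [cite: SerreGaloisCohomology1997, II.§1.1] -/
@[reducible]
def localAction : DistribMulAction (absoluteGaloisGroup E) M :=
  DistribMulAction.compHom M ((resGalOfEmb ι : absoluteGaloisGroup E →ₜ* absoluteGaloisGroup K) :
    absoluteGaloisGroup E →* absoluteGaloisGroup K)

/-- The pin of `localAction`: `σ • m = res_ι σ • m` (definitional). [cite: SerreGaloisCohomology1997, II.§1.1] -/
theorem localAction_smul (σ : absoluteGaloisGroup E) (m : M) :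
    (letI := localAction ι M; σ • m) = resGalOfEmb ι σ • m :=
  rfl

end Coeff

/-! ## §2. The torsion levels `M[p^k]` as continuous representations -/

section Levels

variable {G : Type} [Group G] [TopologicalSpace G] [IsTopologicalGroup G]
  (M : Type) [AddCommGroup M] [DistribMulAction G M] [TopologicalSpace M] [DiscreteTopology M] (p : ℕ)

/-- `M[p^k]`, the `p^k`-torsion of the discrete `G`-module `M` (stable under `G` by the tree's generic instance); VERBATIM the
Summits `SmallImageRttD2Seq.torsionPow`. [cite: Rubin2000, §4.2] -/
abbrev torsionPow (k : ℕ) : AddSubgroup M :=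
  AddSubgroup.torsionBy M ((p ^ k : ℕ) : ℤ)

omit [TopologicalSpace M] [DiscreteTopology M] in
variable {M p} in
/-- Membership in `M[p^k]`: `p^k • m = 0`. [cite: Rubin2000, §4.2] -/
theorem mem_torsionPow_iff (k : ℕ) (m : M) : m ∈ torsionPow M p k ↔ (p ^ k) • m = 0 := by
  rw [torsionPow, AddSubgroup.torsionBy, Submodule.mem_toAddSubgroup, Submodule.mem_torsionBy_iff, natCast_zsmul]

/-- A discrete `G`-module with open stabilisers as a continuous representation (tree `ContinuousRep`), with
`toRepresentation g = (g • ·)`; VERBATIM the Summits `SmallImageRttD2Seq.repOfAction`. [cite: SerreGaloisCohomology1997, I §2.1] -/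
def repOfAction (hstab : ∀ m : M, IsOpen (MulAction.stabilizer G m : Set G)) : ContinuousRep G ℤ M :=
  ContinuousRep.ofStabilizerMemNhdsOne
    { toFun := fun g ↦ (DistribSMul.toAddMonoidHom M g).toIntLinearMap
      map_one' := by ext m; simp
      map_mul' := fun g h ↦ by ext m; simp [mul_smul] }
    (fun m ↦ (hstab m).mem_nhds (by simp))

/-- `repOfAction` restricted to a subgroup `S`, as a `TopRep`, IS the tree's `discreteTopRep S M` (definitional). [cite: SerreGaloisCohomology1997, I §2.1] -/
theorem toTopRep_restrict_repOfAction (hstab : ∀ m : M, IsOpen (MulAction.stabilizer G m : Set G)) (S : Subgroup G) :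
    ((repOfAction M hstab).restrict (GaloisRepresentations.subgroupIncl S)).toTopRep = discreteTopRep S M :=
  rfl

omit [IsTopologicalGroup G] [TopologicalSpace M] [DiscreteTopology M] in
variable {M} in
/-- Open stabilisers pass to the torsion levels. [cite: Rubin2000, §4.2 and App. B.2] -/
theorem isOpen_stabilizer_torsionPow (hstab : ∀ m : M, IsOpen (MulAction.stabilizer G m : Set G)) (k : ℕ)
    (m : ↥(torsionPow M p k)) : IsOpen (MulAction.stabilizer G m : Set G) := by
  have h : (MulAction.stabilizer G m : Set G) = (MulAction.stabilizer G (m : M) : Set G) := by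
    ext g
    simp only [SetLike.mem_coe, MulAction.mem_stabilizer_iff]
    exact ⟨fun h ↦ congrArg Subtype.val h, fun h ↦ Subtype.ext h⟩
  rw [h]; exact hstab m

/-- **`M[p^k]` as a continuous representation of `G`**; VERBATIM the Summits `SmallImageRttD2Seq.torsRep` (definitionally equal).
[cite: Rubin2000, §4.2] -/
def torsRep (hstab : ∀ m : M, IsOpen (MulAction.stabilizer G m : Set G)) (k : ℕ) : ContinuousRep G ℤ ↥(torsionPow M p k) :=
  repOfAction (↥(torsionPow M p k)) (isOpen_stabilizer_torsionPow p hstab k)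

/-- The restricted `torsRep` as a `TopRep` IS `discreteTopRep S M[p^k]` (definitional) — so `H¹` of it IS the tree's
`subgroupH1 S M[p^k]`, and a continuous cocycle class `oneCocycleClass (discreteTopRep S M[p^k]) φ` is an element of it. [cite: SerreGaloisCohomology1997, I §2.2] -/
theorem toTopRep_restrict_torsRep (hstab : ∀ m : M, IsOpen (MulAction.stabilizer G m : Set G)) (k : ℕ) (S : Subgroup G) :
    ((torsRep M p hstab k).restrict (GaloisRepresentations.subgroupIncl S)).toTopRep = discreteTopRep S ↥(torsionPow M p k) :=
  rfl

end Levels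

/-! ## §3. The coefficients `X_k = (𝒪 ⊗ μ_{p^k} ⊗ θ′)^{N_P}` at the place `v` and the localisation of the layer groups -/

section Loc

variable {K : Type} [Field K] [NumberField K] {p : ℕ} [Fact p.Prime] (S : Set (PadicAlgCl p)) (κ : ZpExtension K p)
  (θ' : absoluteGaloisGroup K →ₜ* (padicCoeffIntegers S)ˣ) (P : Set (HeightOneSpectrum (𝓞 K))) (v : HeightOneSpectrum (𝓞 K))

/-- **`Γ_{K_v} → G_P = Gal(K_P/K)`**: the projection after the restriction `res_v` of the chosen embedding `K̄ ↪ K̄_v`; VERBATIM the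
Summits `SmallImageRttD2Seq.locGS`. [cite: NeukirchSchmidtWingberg2008, I §5] -/
def locGS : absoluteGaloisGroup (v.adicCompletion K) →ₜ* GaloisGroupUnramifiedOutside K P :=
  (toUnramifiedQuotCont K P).comp (resGalOfEmb (closureEmb (K := K) (v.adicCompletion K)))

/-- Unfolding `locGS`. [cite: NeukirchSchmidtWingberg2008, I §5] -/
theorem locGS_apply (τ : absoluteGaloisGroup (v.adicCompletion K)) :
    locGS P v τ = toUnramifiedQuot K P (resGalOfEmb (closureEmb (K := K) (v.adicCompletion K)) τ) :=
  rfl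

/-- **The coefficients `X_k = (𝒪 ⊗ μ_{p^k} ⊗ θ′)^{N_P}` of the level groups `levelCohO` as a representation of `Γ_{K_v}`** (through
`locGS`); VERBATIM the Summits `SmallImageRttD2Seq.locCoeffRep`. [cite: JohnsonLeungKings2011, Def. 4.2] [cite: Kato2004Asterisque, §17.13] -/
def locCoeffRep (k : ℕ) :
    ContinuousRep (absoluteGaloisGroup (v.adicCompletion K)) ℤ
      ↥(Representation.invariants ((muTwistO S θ' k).toRepresentation.comp (ramificationSubgroup K P).subtype)) :=
  (coeffGSO S P θ' k).restrict (locGS P v)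

/-- Unfolding `locCoeffRep`: `τ` acts as `π(res_v τ)`. [cite: Kato2004Asterisque, §17.13 (17.13.1)] -/
theorem locCoeffRep_apply (k : ℕ) (τ : absoluteGaloisGroup (v.adicCompletion K)) :
    locCoeffRep S θ' P v k τ = coeffGSO S P θ' k (locGS P v τ) :=
  rfl

/-- **`U_{n,v} → (U_n)_P`**: `locGS` restricted to `U_{n,v} = res_v⁻¹(U_n)`, `U_n = Gal(K̄/K_n)` the `n`-th layer of the `ℤ_p`-extension `κ`,
corestricted to the image `(U_n)_P` of `U_n` in `G_P`; VERBATIM the Summits `SmallImageRttD2Seq.locLayerHom`. [cite: NeukirchSchmidtWingberg2008, I §5] -/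
def locLayerHom (n : ℕ) :
    ↥(localSubgroupOfEmb (κ.layerSubgroup n) (closureEmb (K := K) (v.adicCompletion K))) →ₜ* ↥(imGS P (κ.layerSubgroup n)) where
  toFun τ := ⟨locGS P v τ, Subgroup.mem_map_of_mem _ ((mem_localSubgroupOfEmb_iff _ _ _).mp τ.2)⟩
  map_one' := Subtype.ext (map_one _)
  map_mul' a b := Subtype.ext (map_mul _ _ _)
  continuous_toFun := by
    apply Continuous.subtype_mk
    exact (locGS P v).continuous.comp continuous_subtype_val

/-- Unfolding `locLayerHom`. [cite: NeukirchSchmidtWingberg2008, I §5] -/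
theorem locLayerHom_apply_coe (n : ℕ) (τ : ↥(localSubgroupOfEmb (κ.layerSubgroup n) (closureEmb (K := K) (v.adicCompletion K)))) :
    ((locLayerHom κ P v n τ : ↥(imGS P (κ.layerSubgroup n))) : GaloisGroupUnramifiedOutside K P) = locGS P v τ :=
  rfl

/-- The coefficient morphism over `locLayerHom`: the identity on vectors of `X_k`; VERBATIM the Summits `SmallImageRttD2Seq.locLayerMod`. [cite: NeukirchSchmidtWingberg2008, I §5] -/
def locLayerMod (n k : ℕ) :
    TopRep.res (locLayerHom κ P v n : _ →* _) (subgroupRep (coeffGSO S P θ' k).toTopRep (imGS P (κ.layerSubgroup n))) ⟶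
      subgroupRep (locCoeffRep S θ' P v k).toTopRep (localSubgroupOfEmb (κ.layerSubgroup n) (closureEmb (K := K) (v.adicCompletion K))) :=
  TopRep.ofHom ⟨ContinuousLinearMap.id ℤ _, fun _ ↦ rfl⟩

/-- ★ **The localisation `loc_{n,v} : H¹(G_P(K_n), X_k) → H¹(U_{n,v}, X_k)`** of the layer groups `levelCohO S P θ′ (κ.layerSubgroup n) k 1` at the
place `v` (the cohomology map of the pair (`locLayerHom`, identity)); VERBATIM the Summits `SmallImageRttD2Seq.locNK`.
[cite: NeukirchSchmidtWingberg2008, I §5] [cite: Kato2004Asterisque, §17.13 (17.13.1)] -/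
def locNK (n k : ℕ) :
    levelCohO S P θ' (κ.layerSubgroup n) k 1 →+
      (continuousCohomology 1 (subgroupRep (locCoeffRep S θ' P v k).toTopRep
        (localSubgroupOfEmb (κ.layerSubgroup n) (closureEmb (K := K) (v.adicCompletion K)))) : Type) :=
  (ContinuousCohomology.map (locLayerHom κ P v n) (locLayerMod S κ θ' P v n k) 1).hom.toLinearMap.toAddMonoidHom

/-- Unfolding `locNK`. [cite: Kato2004Asterisque, §17.13 (17.13.1)] -/
theorem locNK_apply (n k : ℕ) (y : levelCohO S P θ' (κ.layerSubgroup n) k 1) :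
    locNK S κ θ' P v n k y = ContinuousCohomology.map (locLayerHom κ P v n) (locLayerMod S κ θ' P v n k) 1 y :=
  rfl

end Loc

/-! ## §4. The vocabulary of the coefficient pairing `⟪a ⊗ ζ, t/p^k⟫ = λ(a t)·ζ` -/

section ZMod

variable (K : Type) [Field K] (n : ℕ)

/-- **`t ↦ t·ζ : ℤ/n → μ_n`** (`ZMod.lift` of `z ↦ z • ζ`); VERBATIM the Summits `SmallImageRttD2Seq.zmodSMulMu`. [cite: NeukirchSchmidtWingberg2008, (7.2.6)] -/
def zmodSMulMu (ζ : MuCarrier K n) : ZMod n →+ MuCarrier K n :=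
  ZMod.lift n ⟨zmultiplesHom (MuCarrier K n) ζ, by
    change (n : ℤ) • ζ = 0
    rw [natCast_zsmul]
    exact muVal_injective K n (by rw [muVal_nsmul, muVal_pow_eq_one, muVal_zero])⟩

/-- `zmodSMulMu ζ z = z • ζ` for `z ∈ ℤ`. [cite: NeukirchSchmidtWingberg2008, (7.2.6)] -/
theorem zmodSMulMu_intCast (ζ : MuCarrier K n) (z : ℤ) : zmodSMulMu K n ζ (z : ZMod n) = z • ζ := by
  rw [zmodSMulMu, ZMod.lift_coe]; rfl

end ZMod

section Lam

variable {p : ℕ} [Fact p.Prime] (S : Set (PadicAlgCl p)) (lam : padicCoeffIntegers S →+ ℤ_[p])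

/-- **`λ mod p^k : 𝒪 →+ ℤ/p^k`** for a `ℤ_p`-linear form `λ : 𝒪 → ℤ_p`; VERBATIM the Summits `SmallImageRttD2Seq.lamZMod`.
[cite: NeukirchSchmidtWingberg2008, (7.2.6)] -/
def lamZMod (k : ℕ) : padicCoeffIntegers S →+ ZMod (p ^ k) :=
  (PadicInt.toZModPow k).toAddMonoidHom.comp lam

/-- Unfolding `lamZMod`. [cite: NeukirchSchmidtWingberg2008, (7.2.6)] -/
theorem lamZMod_apply (k : ℕ) (x : padicCoeffIntegers S) : lamZMod S lam k x = PadicInt.toZModPow k (lam x) := rfl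

end Lam

section Cofree

variable {p : ℕ} [Fact p.Prime] (S : Set (PadicAlgCl p)) (K : Type) [Field K] (θ : FramedGaloisRep K (padicCoeffIntegers S) 1) (k : ℕ)

/-- **`t ↦ t/p^k : 𝒪¹ → M[p^k]`** for `M = (F/𝒪)(θ) = GreenbergSelmer.Cofree θ F` (the tree's `divPowCofreeMk`, valued in the `p^k`-torsion);
VERBATIM the Summits `SmallImageRttD2Seq.divPowTors`. [cite: Kato2004Asterisque, §13.8 (p. 228)] -/
def divPowTors : (Fin 1 → padicCoeffIntegers S) →+ ↥(torsionPow (GreenbergSelmer.Cofree θ (padicCoeffField S)) p k) where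
  toFun t := ⟨GreenbergSelmer.divPowCofreeMk S θ k t, by
    rw [mem_torsionPow_iff, GreenbergSelmer.pow_smul_divPowCofreeMk]⟩
  map_zero' := Subtype.ext (map_zero _)
  map_add' s t := Subtype.ext (map_add _ s t)

/-- Unfolding `divPowTors`. [cite: Kato2004Asterisque, §13.8 (p. 228)] -/
theorem coe_divPowTors_apply (t : Fin 1 → padicCoeffIntegers S) :
    ((divPowTors S K θ k t : ↥(torsionPow (GreenbergSelmer.Cofree θ (padicCoeffField S)) p k)) : GreenbergSelmer.Cofree θ (padicCoeffField S)) =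
      GreenbergSelmer.divPowCofreeMk S θ k t :=
  rfl

/-- **Every `p^k`-torsion class of `(F/𝒪)(θ)` is `t/p^k` for some `t ∈ 𝒪`** (so a pairing on `M[p^k]` is determined by its values on the `t/p^k`).
[cite: Kato2004Asterisque, §13.8 (p. 228)] [cite: Greenberg1989, §1 p. 98] -/
theorem exists_divPowTors_eq (m : ↥(torsionPow (GreenbergSelmer.Cofree θ (padicCoeffField S)) p k)) :
    ∃ t : Fin 1 → padicCoeffIntegers S, divPowTors S K θ k t = m := by
  obtain ⟨m, hm⟩ := m
  obtain ⟨f, rfl⟩ := GreenbergSelmer.cofreeMk_surjective (padicCoeffField S) θ m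
  have hm' : ((p ^ k : ℕ) : padicCoeffField S) • f ∈ GreenbergSelmer.lattice 1 (padicCoeffIntegers S) (padicCoeffField S) := by
    rw [← GreenbergSelmer.ker_cofreeMk (padicCoeffField S) θ, LinearMap.mem_ker, Nat.cast_smul_eq_nsmul, map_nsmul]
    exact (mem_torsionPow_iff _ _).mp hm
  obtain ⟨t, ht⟩ := (GreenbergSelmer.mem_lattice_iff _).mp hm'
  refine ⟨t, Subtype.ext ?_⟩
  have hp : (p : padicCoeffField S) ≠ 0 := Nat.cast_ne_zero.mpr (Fact.out : p.Prime).ne_zero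
  rw [coe_divPowTors_apply, GreenbergSelmer.divPowCofreeMk_apply, ht, smul_smul, Nat.cast_pow, ← mul_pow, inv_mul_cancel₀ hp, one_pow, one_smul]

end Cofree

/-! ## §5. Kato's `p𝔣`-depleted series `L_{p𝔣}(ψ̄, χ, s)` depleted at an ideal -/

section Values

variable {K : Type} [Field K] [NumberField K]

/-- **The `𝔠`-depleted twisted Dirichlet series `L_{𝔠}(ψ̄, χ, s) = Σ_{(𝔞, 𝔠) = 1} ψ̄(𝔞) χ(𝔞) N(𝔞)^{−s}`** for an IDEAL `𝔠` of `𝓞_K` ("`L_{p𝔣}(ψ, χ, s)`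
denotes `Σ_𝔞 ψ(𝔞)χ(𝔞)N(𝔞)^{−s}` in which `𝔞` ranges over all ideals of `O_K` which are prime to `p𝔣`", Prop. 15.9) — VERBATIM the sibling
`CM.depletedHeckeLSeries` (which depletes at `(m)`, `m ∈ ℕ`) with `Ideal.span {m}` replaced by `𝔠`; `ψ̄(𝔞) = \overline{ψ(𝔞)}` in the first slot
(reading (R1) of `EllipticZetaReciprocity.lean`), `χ(𝔞)` the tree's `heckeIdealValue χ 𝔞` (arithmetic Artin symbol, reading (R2)).
[cite: Kato2004Asterisque, Prop. 15.9 (p. 258) and §15.7 (p. 256)] -/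
def depletedHeckeLSeriesIdeal (ψ : HeckeCharacter K) (χ : absoluteGaloisGroup K →ₜ* ℂˣ) (𝔠 : Ideal (𝓞 K)) (s : ℂ) : ℂ :=
  ∑' I : Ideal (𝓞 K),
    if IsCoprime I 𝔠 then
      conj (CM.heckeCharIdealValue ψ I) * heckeIdealValue χ I * ((Ideal.absNorm I : ℕ) : ℂ) ^ (-s)
    else 0

/-- **`L` is the entire continuation of `L_{𝔠}(ψ̄, χ, s)`**: `L` is entire and agrees with `depletedHeckeLSeriesIdeal ψ χ 𝔠` on `re s > 3/2`
(VERBATIM the sibling `CM.IsDepletedHeckeL` at an ideal). Its value `L 1` is Kato's `L_{p𝔣}(ψ̄, χ, 1)` for `𝔠 = p𝔣` (`r = 1`).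
[cite: Kato2004Asterisque, Prop. 15.9 (p. 258)] -/
def IsDepletedHeckeLIdeal (ψ : HeckeCharacter K) (χ : absoluteGaloisGroup K →ₜ* ℂˣ) (𝔠 : Ideal (𝓞 K)) (L : ℂ → ℂ) : Prop :=
  Differentiable ℂ L ∧ ∀ s : ℂ, 3 / 2 < s.re → L s = depletedHeckeLSeriesIdeal ψ χ 𝔠 s

end Values

end Literature.NumberTheory.EllipticCurves.Kato2004.LocalTate

end
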